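import Mathlib

/-!
# Clause 13-J, brick B2: the TAYLOR-REMAINDER OPERATOR of the straight matched filament in closed form,
# `∫ ((τ−σ)²+q)^{-3/2} (f τ − f σ − (τ−σ) f′σ) dσ = (2/q) f τ − ∫ (2q − (τ−σ)²)((τ−σ)²+q)^{-5/2} f σ dσ`

Route `FilamentSkeletonRss`, child 28296 `Clause13NearStraight` of `SkeletonJ1G` (stmt-27849); design memo
`filament-plan/DESIGN-28296-clause13-g12.md` §4 B2.  By B1 (`…Clause13StraightSelfTerm.selfTerm_straight`) the self term of the
linearised map on the straight constant-core model is `t × M_q[Y]`, `M_q[f](τ) = ∫ K₃(τ−σ)(f τ − f σ − (τ−σ) f′σ) dσ`,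
`K₃(s) = (s²+q)^{-3/2}`.  This file (scalar `f`, applied componentwise later) proves the closed form
`M_q[f](τ) = (2/q) f(τ) − (K ∗ f)(τ)`, `K(s) = (2q − s²)(s²+q)^{-5/2}` (`taylorRemainderOp_eq`), for `f ∈ C¹` with `f, f′` bounded:
`∫ K₃ = 2/q` (antiderivative `s/(q√(s²+q))`, whole-line FTC), one whole-line integration by parts with `u(σ) = (τ−σ)K₃(τ−σ)`
(Mathlib `integral_mul_deriv_eq_deriv_mul_of_integrable`), and the pointwise identity `2K₃(s) + s K₃′(s) = K(s)`.
So on the model, the linearised normal self-induction is `(Γγ/4π)·t × ((2/q)Y − K ∗ Y)`, whose Fourier multiplier is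
`(Γγ/4π)(2/q)𝔖(k√q)` (`liaSym`; B3).  Lane ns-filament-19175-p1 g12; `--supports stmt-NavierStokesRegularity-28296 --as helper`.
HONEST FRAMING: calculus for a HYPOTHETICAL filament skeleton on the NEGATIVE side of a MODEL route; nothing here bears on
Navier–Stokes regularity or blow-up.
-/

noncomputable section

open MeasureTheory Filter Topology

namespace Summit.NavierStokesRegularity.NavierStokesRegularity.Theorems.MatchedKernel
set_option linter.dupNamespace false

/-! ### The kernels -/

/-- `(s²+q)^{-3/2} ≤ c·(1+s²)⁻¹` with `c = (1+q)/(q√q)`-type constant: domination by the Cauchy kernel (`q > 0`). [folklore] -/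
theorem K3_le_inv_one_add_sq {q : ℝ} (hq : 0 < q) (s : ℝ) :
    ((s ^ 2 + q) ^ (3 / 2 : ℝ))⁻¹ ≤ (Real.sqrt q)⁻¹ * (max 1 q⁻¹) * (1 + s ^ 2)⁻¹ := by
  have hσ : 0 < s ^ 2 + q := by positivity
  -- `(s²+q)^{-3/2} ≤ (√q)⁻¹ (s²+q)⁻¹` and `(s²+q)⁻¹ ≤ max 1 q⁻¹ · (1+s²)⁻¹`
  have h1 : ((s ^ 2 + q) ^ (3 / 2 : ℝ))⁻¹ ≤ (Real.sqrt q)⁻¹ * (s ^ 2 + q)⁻¹ := by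
    rw [← Real.rpow_neg hσ.le, show (-(3/2:ℝ)) = -(1/2) + -1 by norm_num, Real.rpow_add hσ, Real.rpow_neg_one]
    gcongr
    rw [Real.rpow_neg hσ.le, ← Real.sqrt_eq_rpow]
    exact inv_anti₀ (Real.sqrt_pos.mpr hq) (Real.sqrt_le_sqrt (by nlinarith))
  have h2 : (s ^ 2 + q)⁻¹ ≤ max 1 q⁻¹ * (1 + s ^ 2)⁻¹ := by
    rw [← div_eq_mul_inv, le_div_iff₀ (by positivity), inv_mul_le_iff₀ hσ]
    have hm1 : (1:ℝ) ≤ max 1 q⁻¹ := le_max_left _ _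
    have hm2 : q⁻¹ ≤ max 1 q⁻¹ := le_max_right _ _
    have : 1 ≤ max 1 q⁻¹ * q := by
      calc (1:ℝ) = q⁻¹ * q := by field_simp
        _ ≤ max 1 q⁻¹ * q := by gcongr
    nlinarith [sq_nonneg s]
  calc ((s ^ 2 + q) ^ (3 / 2 : ℝ))⁻¹ ≤ (Real.sqrt q)⁻¹ * (s ^ 2 + q)⁻¹ := h1
    _ ≤ (Real.sqrt q)⁻¹ * (max 1 q⁻¹ * (1 + s ^ 2)⁻¹) := by gcongr
    _ = _ := by ring

/-- `|s|·(s²+q)^{-3/2} ≤ (s²+q)⁻¹ ≤ max 1 q⁻¹ · (1+s²)⁻¹`. [folklore] -/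
theorem abs_mul_K3_le {q : ℝ} (hq : 0 < q) (s : ℝ) :
    |s| * ((s ^ 2 + q) ^ (3 / 2 : ℝ))⁻¹ ≤ (max 1 q⁻¹) * (1 + s ^ 2)⁻¹ := by
  have hσ : 0 < s ^ 2 + q := by positivity
  have hs : |s| ≤ Real.sqrt (s ^ 2 + q) := by
    rw [← Real.sqrt_sq_eq_abs]; exact Real.sqrt_le_sqrt (by linarith)
  have h1 : |s| * ((s ^ 2 + q) ^ (3 / 2 : ℝ))⁻¹ ≤ (s ^ 2 + q)⁻¹ := by
    rw [← Real.rpow_neg hσ.le, show (-(3/2:ℝ)) = -(1/2) + -1 by norm_num, Real.rpow_add hσ, Real.rpow_neg_one,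
      Real.rpow_neg hσ.le, ← Real.sqrt_eq_rpow, ← mul_assoc]
    have hsq : 0 < Real.sqrt (s ^ 2 + q) := Real.sqrt_pos.mpr hσ
    calc |s| * (Real.sqrt (s ^ 2 + q))⁻¹ * (s ^ 2 + q)⁻¹ ≤ Real.sqrt (s ^ 2 + q) * (Real.sqrt (s ^ 2 + q))⁻¹ * (s ^ 2 + q)⁻¹ := by
          gcongr
      _ = (s ^ 2 + q)⁻¹ := by rw [mul_inv_cancel₀ hsq.ne', one_mul]
  have h2 : (s ^ 2 + q)⁻¹ ≤ max 1 q⁻¹ * (1 + s ^ 2)⁻¹ := by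
    rw [← div_eq_mul_inv, le_div_iff₀ (by positivity), inv_mul_le_iff₀ hσ]
    have : 1 ≤ max 1 q⁻¹ * q := by
      calc (1:ℝ) = q⁻¹ * q := by field_simp
        _ ≤ max 1 q⁻¹ * q := by gcongr; exact le_max_right _ _
    nlinarith [sq_nonneg s, le_max_left (1:ℝ) q⁻¹]
  exact h1.trans h2

/-- `∫ (s²+q)^{-3/2} ds = 2/q` (antiderivative `s/(q√(s²+q))`). [folklore] -/
theorem integral_K3 {q : ℝ} (hq : 0 < q) : ∫ s : ℝ, ((s ^ 2 + q) ^ (3 / 2 : ℝ))⁻¹ = 2 / q := by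
  have hσ : ∀ s : ℝ, 0 < s ^ 2 + q := fun s => by positivity
  -- the antiderivative and its derivative
  have hderiv : ∀ s : ℝ, HasDerivAt (fun s : ℝ => s / (q * Real.sqrt (s ^ 2 + q))) (((s ^ 2 + q) ^ (3 / 2 : ℝ))⁻¹) s := by
    intro s
    have h1 : HasDerivAt (fun s : ℝ => Real.sqrt (s ^ 2 + q)) (s / Real.sqrt (s ^ 2 + q)) s := by
      have := ((hasDerivAt_pow 2 s).add_const q).sqrt (hσ s).ne'
      convert this using 1; ring
    have h2 : HasDerivAt (fun s : ℝ => q * Real.sqrt (s ^ 2 + q)) (q * (s / Real.sqrt (s ^ 2 + q))) s := h1.const_mul q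
    have hne : q * Real.sqrt (s ^ 2 + q) ≠ 0 := mul_ne_zero hq.ne' (Real.sqrt_pos.mpr (hσ s)).ne'
    have h3 := (hasDerivAt_id s).div h2 hne
    refine h3.congr_deriv ?_
    have hsq : Real.sqrt (s ^ 2 + q) ^ 2 = s ^ 2 + q := Real.sq_sqrt (hσ s).le
    have hsq0 : 0 < Real.sqrt (s ^ 2 + q) := Real.sqrt_pos.mpr (hσ s)
    have h32 : (s ^ 2 + q) ^ (3 / 2 : ℝ) = (s ^ 2 + q) * Real.sqrt (s ^ 2 + q) := by
      rw [show (3/2:ℝ) = 1 + 1/2 by norm_num, Real.rpow_add (hσ s), Real.rpow_one, Real.sqrt_eq_rpow]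
    rw [h32]
    simp only [id, one_mul]
    rw [div_eq_iff (pow_ne_zero 2 hne)]
    have e1 : q * Real.sqrt (s ^ 2 + q) - s * (q * (s / Real.sqrt (s ^ 2 + q)))
        = q * (Real.sqrt (s ^ 2 + q) ^ 2 - s ^ 2) / Real.sqrt (s ^ 2 + q) := by
      field_simp
    rw [e1, hsq]
    field_simp
    nlinarith [hsq, hsq0, hσ s]
  -- integrability and the limits `±1/q`
  have hint : Integrable (fun s : ℝ => ((s ^ 2 + q) ^ (3 / 2 : ℝ))⁻¹) := by
    refine ((integrable_inv_one_add_sq.const_mul ((Real.sqrt q)⁻¹ * max 1 q⁻¹))).mono' ?_ ?_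
    · exact (((continuous_pow 2).add continuous_const).rpow_const (fun s => Or.inl (hσ s).ne')).inv₀
        (fun s => (Real.rpow_pos_of_pos (hσ s) _).ne') |>.aestronglyMeasurable
    · refine Eventually.of_forall fun s => ?_
      rw [Real.norm_of_nonneg (inv_nonneg.mpr (Real.rpow_nonneg (hσ s).le _))]
      exact K3_le_inv_one_add_sq hq s
  have hlim : ∀ (l : Filter ℝ) (sgn : ℝ), (Tendsto (fun s : ℝ => s / Real.sqrt (s ^ 2 + q)) l (𝓝 sgn)) →
      Tendsto (fun s : ℝ => s / (q * Real.sqrt (s ^ 2 + q))) l (𝓝 (sgn / q)) := by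
    intro l sgn h
    have : (fun s : ℝ => s / (q * Real.sqrt (s ^ 2 + q))) = fun s => (s / Real.sqrt (s ^ 2 + q)) / q := by
      funext s; rw [div_div, mul_comm]
    rw [this]; exact h.div_const q
  -- `s/√(s²+q) → ±1`
  have htop : Tendsto (fun s : ℝ => s / Real.sqrt (s ^ 2 + q)) atTop (𝓝 1) := by
    have h1 : Tendsto (fun s : ℝ => Real.sqrt (1 + q / s ^ 2)) atTop (𝓝 1) := by
      have : Tendsto (fun s : ℝ => 1 + q / s ^ 2) atTop (𝓝 (1 + 0)) :=
        tendsto_const_nhds.add ((tendsto_const_nhds.div_atTop (tendsto_pow_atTop two_ne_zero)))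
      simpa using this.sqrt
    have h2 := h1.inv₀ one_ne_zero
    rw [inv_one] at h2
    refine h2.congr' ?_
    filter_upwards [eventually_gt_atTop (0:ℝ)] with s hs
    have e : s ^ 2 + q = s ^ 2 * (1 + q / s ^ 2) := by field_simp
    have : Real.sqrt (s ^ 2 + q) = s * Real.sqrt (1 + q / s ^ 2) := by
      rw [e, Real.sqrt_mul (sq_nonneg s), Real.sqrt_sq hs.le]
    rw [this, div_mul_eq_div_div, div_self hs.ne', one_div]
  have hbot : Tendsto (fun s : ℝ => s / Real.sqrt (s ^ 2 + q)) atBot (𝓝 (-1)) := by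
    have : (fun s : ℝ => s / Real.sqrt (s ^ 2 + q)) = fun s => -((-s) / Real.sqrt ((-s) ^ 2 + q)) := by
      funext s; rw [neg_sq, neg_div, neg_neg]
    rw [this]
    exact (htop.comp tendsto_neg_atBot_atTop).neg
  have key := integral_of_hasDerivAt_of_tendsto hderiv hint (hlim _ _ hbot) (hlim _ _ htop)
  rw [key]; ring


/-! ### The closed form of the Taylor-remainder operator -/

/-- The IBP kernel `h(s) = s·(s²+q)^{-3/2}` has derivative `(s²+q)^{-3/2} − 3s²(s²+q)^{-5/2}`. [folklore] -/
theorem hasDerivAt_mul_K3 {q : ℝ} (hq : 0 < q) (s : ℝ) :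
    HasDerivAt (fun s : ℝ => s * ((s ^ 2 + q) ^ (3 / 2 : ℝ))⁻¹)
      (((s ^ 2 + q) ^ (3 / 2 : ℝ))⁻¹ - 3 * s ^ 2 * ((s ^ 2 + q) ^ (5 / 2 : ℝ))⁻¹) s := by
  have hσ : 0 < s ^ 2 + q := by positivity
  have hk : HasDerivAt (fun s : ℝ => ((s ^ 2 + q) ^ (3 / 2 : ℝ))⁻¹) (-3 * s * ((s ^ 2 + q) ^ (5 / 2 : ℝ))⁻¹) s := by
    have h1 : HasDerivAt (fun s : ℝ => s ^ 2 + q) (2 * s) s := by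
      simpa using (hasDerivAt_pow 2 s).add_const q
    have h2 := h1.rpow_const (p := -(3/2 : ℝ)) (Or.inl hσ.ne')
    have hfun : (fun s : ℝ => ((s ^ 2 + q) ^ (3 / 2 : ℝ))⁻¹) = fun s => (s ^ 2 + q) ^ (-(3/2) : ℝ) := by
      funext s; rw [Real.rpow_neg (by positivity)]
    rw [hfun]
    refine h2.congr_deriv ?_
    rw [show (-(3/2:ℝ)) - 1 = -(5/2) by norm_num, Real.rpow_neg hσ.le]
    ring
  have := (hasDerivAt_id s).mul hk
  refine this.congr_deriv ?_
  simp only [id]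
  ring

/-- **B2 — the Taylor-remainder operator in closed form.**  For `f ∈ C¹(ℝ)` with `|f|, |f′| ≤ B` and `q > 0`,
`∫ ((τ−σ)²+q)^{-3/2} (f τ − f σ − (τ−σ) f′σ) dσ = (2/q) f τ − ∫ (2q − (τ−σ)²) ((τ−σ)²+q)^{-5/2} f σ dσ`. [folklore] -/
theorem taylorRemainderOp_eq {q B : ℝ} (hq : 0 < q) {f : ℝ → ℝ} (hf : ContDiff ℝ 1 f) (hfb : ∀ x, |f x| ≤ B)
    (hf'b : ∀ x, |deriv f x| ≤ B) (τ : ℝ) :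
    ∫ σ : ℝ, (((τ - σ) ^ 2 + q) ^ (3 / 2 : ℝ))⁻¹ * (f τ - f σ - (τ - σ) * deriv f σ)
      = 2 / q * f τ - ∫ σ : ℝ, (2 * q - (τ - σ) ^ 2) * (((τ - σ) ^ 2 + q) ^ (5 / 2 : ℝ))⁻¹ * f σ := by
  have hB : 0 ≤ B := (abs_nonneg _).trans (hfb 0)
  have hσ : ∀ s : ℝ, 0 < s ^ 2 + q := fun s => by positivity
  have hfc : Continuous f := hf.continuous
  have hf'c : Continuous (deriv f) := hf.continuous_deriv le_rfl
  have hfd : ∀ x, HasDerivAt f (deriv f x) x := fun x => (hf.differentiable (by norm_num) x).hasDerivAt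
  -- the kernels along `σ ↦ τ − σ` and their integrability
  set K3 : ℝ → ℝ := fun s => ((s ^ 2 + q) ^ (3 / 2 : ℝ))⁻¹ with hK3
  set h : ℝ → ℝ := fun s => s * ((s ^ 2 + q) ^ (3 / 2 : ℝ))⁻¹ with hh
  set h' : ℝ → ℝ := fun s => ((s ^ 2 + q) ^ (3 / 2 : ℝ))⁻¹ - 3 * s ^ 2 * ((s ^ 2 + q) ^ (5 / 2 : ℝ))⁻¹ with hh'
  have hK3c : Continuous K3 := (((continuous_pow 2).add continuous_const).rpow_const
    (fun s => Or.inl (hσ s).ne')).inv₀ (fun s => (Real.rpow_pos_of_pos (hσ s) _).ne')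
  have hK5c : Continuous (fun s : ℝ => ((s ^ 2 + q) ^ (5 / 2 : ℝ))⁻¹) := (((continuous_pow 2).add continuous_const).rpow_const
    (fun s => Or.inl (hσ s).ne')).inv₀ (fun s => (Real.rpow_pos_of_pos (hσ s) _).ne')
  have hK3i : Integrable K3 := by
    refine ((integrable_inv_one_add_sq.const_mul ((Real.sqrt q)⁻¹ * max 1 q⁻¹))).mono' hK3c.aestronglyMeasurable ?_
    exact Eventually.of_forall fun s => by
      rw [Real.norm_of_nonneg (inv_nonneg.mpr (Real.rpow_nonneg (hσ s).le _))]; exact K3_le_inv_one_add_sq hq s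
  have hhi : Integrable h := by
    refine ((integrable_inv_one_add_sq.const_mul (max 1 q⁻¹))).mono' (continuous_id.mul hK3c).aestronglyMeasurable ?_
    exact Eventually.of_forall fun s => by
      rw [Real.norm_eq_abs, abs_mul, abs_of_nonneg (inv_nonneg.mpr (Real.rpow_nonneg (hσ s).le _))]
      exact abs_mul_K3_le hq s
  -- `h′ = K3 − 3 s² K5`, and `3 s² K5 = 3 K3 − 3 q K5`; we bound `|h′| ≤ 4 K3`
  have hK5le : ∀ s : ℝ, s ^ 2 * ((s ^ 2 + q) ^ (5 / 2 : ℝ))⁻¹ ≤ ((s ^ 2 + q) ^ (3 / 2 : ℝ))⁻¹ := by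
    intro s
    rw [← Real.rpow_neg (hσ s).le, ← Real.rpow_neg (hσ s).le,
      show (-(3/2:ℝ)) = 1 + -(5/2) by norm_num, Real.rpow_add (hσ s), Real.rpow_one]
    exact mul_le_mul_of_nonneg_right (by linarith [hq.le]) (Real.rpow_nonneg (hσ s).le _)
  have hh'c : Continuous h' := hK3c.sub ((continuous_const.mul (continuous_pow 2)).mul hK5c)
  have hh'i : Integrable h' := by
    refine ((hK3i.norm.const_mul 4)).mono' hh'c.aestronglyMeasurable (Eventually.of_forall fun s => ?_)
    have hk3 : 0 ≤ K3 s := inv_nonneg.mpr (Real.rpow_nonneg (hσ s).le _)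
    have hk5 : 0 ≤ s ^ 2 * ((s ^ 2 + q) ^ (5 / 2 : ℝ))⁻¹ := by positivity
    rw [Real.norm_eq_abs, Real.norm_of_nonneg hk3]
    simp only [hh', hK3] at *
    rw [abs_le]; constructor <;> nlinarith [hK5le s]
  -- integrability of the three pieces (translated kernels × bounded continuous functions)
  have hT : ∀ {g : ℝ → ℝ}, Integrable g → Integrable (fun σ => g (τ - σ)) := fun hg => hg.comp_sub_left τ
  have hbdd : ∀ {g : ℝ → ℝ} {φ : ℝ → ℝ}, Integrable g → Continuous φ → (∀ x, |φ x| ≤ B) →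
      Integrable (fun σ => g (τ - σ) * φ σ) := by
    intro g φ hg hφ hφb
    have h1 : Integrable (fun σ => φ σ * g (τ - σ)) :=
      (hT hg).bdd_mul (c := B) hφ.aestronglyMeasurable (Eventually.of_forall fun x => by
        rw [Real.norm_eq_abs]; exact hφb x)
    exact h1.congr (Eventually.of_forall fun σ => mul_comm _ _)
  have hI1 : Integrable (fun σ => K3 (τ - σ) * f τ) := (hT hK3i).mul_const _
  have hI2 : Integrable (fun σ => K3 (τ - σ) * f σ) := hbdd hK3i hfc hfb
  have hI3 : Integrable (fun σ => h (τ - σ) * deriv f σ) := hbdd hhi hf'c hf'b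
  -- split the left-hand side
  have hI12 : Integrable (fun σ => K3 (τ - σ) * f τ - K3 (τ - σ) * f σ) := hI1.sub hI2
  have hsplit : ∫ σ : ℝ, (((τ - σ) ^ 2 + q) ^ (3 / 2 : ℝ))⁻¹ * (f τ - f σ - (τ - σ) * deriv f σ)
      = (∫ σ : ℝ, K3 (τ - σ) * f τ) - (∫ σ : ℝ, K3 (τ - σ) * f σ) - ∫ σ : ℝ, h (τ - σ) * deriv f σ := by
    have hfun : (fun σ : ℝ => (((τ - σ) ^ 2 + q) ^ (3 / 2 : ℝ))⁻¹ * (f τ - f σ - (τ - σ) * deriv f σ))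
        = fun σ => (K3 (τ - σ) * f τ - K3 (τ - σ) * f σ) - h (τ - σ) * deriv f σ := by
      funext σ; simp only [hK3, hh]; ring
    rw [hfun, integral_sub hI12 hI3, integral_sub hI1 hI2]
  -- `∫ K3(τ−σ) dσ · f τ = (2/q) f τ`
  have hconst : ∫ σ : ℝ, K3 (τ - σ) * f τ = 2 / q * f τ := by
    rw [integral_mul_const, integral_sub_left_eq_self K3 volume τ, hK3, integral_K3 hq]
  -- integration by parts: `∫ h(τ−σ) f′σ dσ = ∫ h′(τ−σ) f σ dσ`
  have hIBP : ∫ σ : ℝ, h (τ - σ) * deriv f σ = ∫ σ : ℝ, h' (τ - σ) * f σ := by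
    have hu : ∀ σ : ℝ, HasDerivAt (fun σ => h (τ - σ)) (-h' (τ - σ)) σ := by
      intro σ
      have h1 := hasDerivAt_mul_K3 hq (τ - σ)
      have h2 : HasDerivAt (fun σ : ℝ => τ - σ) (-1) σ := by simpa using (hasDerivAt_id σ).const_sub τ
      have := h1.comp σ h2
      refine (this : HasDerivAt (fun σ => h (τ - σ)) _ σ).congr_deriv ?_
      simp only [hh']; ring
    have key := integral_mul_deriv_eq_deriv_mul_of_integrable (u := fun σ => h (τ - σ)) (u' := fun σ => -h' (τ - σ))
      (v := f) (v' := deriv f) (fun σ _ => hu σ) (fun σ _ => hfd σ) hI3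
      (by simpa [Pi.mul_def, neg_mul] using (hbdd hh'i hfc hfb).neg) (hbdd hhi hfc hfb)
    rw [key, ← integral_neg]
    refine integral_congr_ae (Eventually.of_forall fun σ => ?_)
    ring
  -- assemble: `K3 + h′ = (2q − s²) K5`
  have hI4 : Integrable (fun σ => h' (τ - σ) * f σ) := hbdd hh'i hfc hfb
  rw [hsplit, hconst, hIBP, sub_sub, ← integral_add hI2 hI4]
  congr 1
  refine integral_congr_ae (Eventually.of_forall fun σ => ?_)
  simp only [hK3, hh']
  have hs := hσ (τ - σ)
  -- `K3 = (s²+q) · K5`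
  have hrel : (((τ - σ) ^ 2 + q) ^ (3 / 2 : ℝ))⁻¹ = ((τ - σ) ^ 2 + q) * (((τ - σ) ^ 2 + q) ^ (5 / 2 : ℝ))⁻¹ := by
    rw [← Real.rpow_neg hs.le, ← Real.rpow_neg hs.le, show (-(3/2:ℝ)) = 1 + -(5/2) by norm_num,
      Real.rpow_add hs, Real.rpow_one]
  rw [hrel]
  ring

end Summit.NavierStokesRegularity.NavierStokesRegularity.Theorems.MatchedKernel
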